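import Summits.BirchSwinnertonDyer.BirchSwinnertonDyer.Theorems.GenusKolyvaginAtTwoGenusPrimitiveSupplyAtTwoPrimeHeegnerTwinDichotomyOfFacts
import Summits.BirchSwinnertonDyer.BirchSwinnertonDyer.Theorems.GenusKolyvaginAtTwoGenusPrimitiveSupplyAtTwoSupplyDEF1OfDuality
import HarnessLib

/-!
# Route `GenusKolyvaginAtTwo`, crux #2 `GenusPrimitiveSupplyAtTwo` (stmt-BirchSwinnertonDyer-22136):
# SUPPLY″ (the DEF = 1 Sel₂-minimal twin beyond every bound) with NO Mazur–Rubin named fact — `prop33_rat` on the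
# `#Sel₂ = 1` cell REPLACED by the 2-parity theorem, the Cassels–Tate pairing and modularity (via Cor. 3.4 (i) UP, p628133)

Width seat `bsd-line-gk2-p4` g9 (cell `bsd-f1-sign2`), sixteenth file of the twisting-prime series (crux workfile
`Lines/genus-supply-depth-class.md` §4). THEOREMS ONLY (no definition, no named fact, no `sorry`); helper
`--supports stmt-BirchSwinnertonDyer-22136`; no item is closed; BSD is not proved by any of this.

gk2-p5 g8's `…SupplyDEF1OfDuality` (p626232) removed `MazurRubin2010.cor34i_singleton_rat` from the habitat SUPPLY″
(`supply_DEF1_minimalTwin_of_duality` / `…_habitat_of_duality`), leaving BY NAME `MazurRubin2010.prop33_rat` — used only on the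
`Δ < 0`, `#Sel₂(W) = 1` cell, through `exists_prime_heegnerField_minimalTwin_of_prop33` (prime Heegner twin of a `Ш[2]`-free rank-`0` curve is
`Sel₂`-minimal). That step is Cor. 3.4 (i) UP with `Sel₂(W) = 0` (trivially strict): this seat's
`GenusKolyTwin.natCard_selmerGroup_twin_eq_two_of_facts` (p628710) proves it modulo {Poitou–Tate, Tate χ, 2-parity (route item
`TwoParityDD`), Cassels–Tate (route item `CasselsTatePairingRat`), modularity (route item `ModularityExistsNewform`)}. Hence:

* §38 `exists_prime_heegnerField_minimalTwin_of_facts` — gk2-p5 g6's `exists_prime_heegnerField_minimalTwin_of_prop33` (p607245) with `h33`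
  replaced by those displayed items (proof verbatim, last line swapped);
* §39 `supply_DEF1_minimalTwin_of_facts` / `supply_DEF1_minimalTwin_habitat_of_facts` — gk2-p5 g8's `…_of_duality` statements VERBATIM with
  `h33` replaced: **SUPPLY″ on the habitat is kernel modulo {PT, Tate χ, 2-parity, Cassels–Tate, modularity, T-A, T-V} — NO Mazur–Rubin
  named fact (`cor34i_singleton_rat`, `prop33_rat`) remains**; every Čebotarev/Dirichlet input is proved. The twin's analytic rank one
  is NOT asserted (rank-one `2`-converse / GZK, as for stub A); the Δ > 0 cells still carry the cell-typed T-A / T-V.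

References: [MazurRubin2010] Prop. 3.3, Cor. 3.4 (i), Prop. 5.3; [DokchitserDokchitserAnnals2010] Thm. 1.4; [MilneADT2006] I 2.8, 4.10, 6.13;
[Kramer1981] Prop. 6; [GrossLMS1991] §1 (p. 235).
-/

set_option linter.dupNamespace false -- tree convention: `Summit.BirchSwinnertonDyer.BirchSwinnertonDyer.Theorems` (summit = sub-problem)
set_option autoImplicit false

noncomputable section

open scoped Classical Pointwise

open NumberField WeierstrassCurve IsDedekindDomain
open Literature.NumberTheory.EllipticCurves Literature.NumberTheory.QuadraticFields
open Literature.NumberTheory.GaloisRepresentations Literature.NumberTheory.GaloisCohomology Literature.NumberTheory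
open Literature.NumberTheory.EllipticCurves.ModularForms (exists_isNewformOf)
open Summit.BirchSwinnertonDyer.Rank1Residual.F1Sign2

namespace Summit.BirchSwinnertonDyer.BirchSwinnertonDyer.Theorems.GenusKolyTwin

open Summit.BirchSwinnertonDyer.BirchSwinnertonDyer.Theorems.GenusKolyTwistingPrime (supply_DEF1_minimalTwin_rowOne_of_duality)

variable (W : WeierstrassCurve ℚ) [W.IsElliptic] [W.IsGloballyMinimal]

/-! ## §38 The `Ш[2]`-free rank-`0` cell: prime Heegner fields beyond every bound with a `Sel₂`-minimal twin, `prop33`-free -/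

/-- **`#Sel₂(W) = 1`, `Δ_W < 0`: beyond every bound a prime Heegner field `K = ℚ(√−ℓ)` carrying every K-clause of crux 22136, `2` split,
DEF = 1 (one root of the `2`-division cubic mod `ℓ`), and a GLOBALLY MINIMAL twin `Wd ≅ W^{(−ℓ)}` with `#Sel₂(Wd) = 2`** — gk2-p5 g6's
`exists_prime_heegnerField_minimalTwin_of_prop33` with `MazurRubin2010.prop33_rat` REPLACED by the displayed print items {Poitou–Tate duality,
Tate's local Euler characteristic, 2-parity, Cassels–Tate, modularity} (the `#Sel₂ = 1 ⟹ twin = 2` step is Cor. 3.4 (i) UP for the trivially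
strict `Sel₂(W) = 0`, `natCard_selmerGroup_twin_eq_two_of_facts`). [cite: MazurRubin2010, Cor. 3.4 (i), Prop. 3.3]
[cite: DokchitserDokchitserAnnals2010, Thm. 1.4] [cite: GrossLMS1991, §1 (p. 235)] -/
theorem exists_prime_heegnerField_minimalTwin_of_facts
    (hPT : poitouTate_selmerStructure_duality_real ℚ)
    (hEP : ∀ v : HeightOneSpectrum (𝓞 ℚ), localEulerPoincareCharacteristic (v.adicCompletion ℚ))
    (hpar : ∀ V : WeierstrassCurve ℚ, p_parity V 2)
    (hCT : WeierstrassCurve.exists_casselsTate_pairing (K := ℚ)) (hmod : exists_isNewformOf)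
    (hΔ : W.Δ < 0) (h1 : Nat.card (W.selmerGroup 2) = 1) (n : ℕ) :
    ∃ (K : Type) (_ : Field K) (_ : NumberField K) (ℓ : ℕ), ℓ.Prime ∧ n < ℓ ∧
      IsImaginaryQuadratic K ∧ discr K = -(ℓ : ℤ) ∧ Odd (discr K) ∧ discr K ≠ -3 ∧
      SatisfiesHeegnerHypothesis (W.conductorNorm ℤ) K ∧
      ¬ IsSquare ((discr K : ℚ) * -|W.Δ|) ∧ ¬ IsSquare ((discr K : ℚ) * (-(2 * |W.Δ|))) ∧
      ((Ideal.span {(2 : ℤ)}).primesOver (𝓞 K)).ncard = 2 ∧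
      (∃! x : ZMod ℓ, 4 * x ^ 3 + ((integralModelInt W).b₂ : ZMod ℓ) * x ^ 2 +
        2 * ((integralModelInt W).b₄ : ZMod ℓ) * x + ((integralModelInt W).b₆ : ZMod ℓ) = 0) ∧
      ∃ (Wd : WeierstrassCurve ℚ) (_ : Wd.IsElliptic) (_ : Wd.IsGloballyMinimal),
        (∃ C : VariableChange ℚ, C • W.quadraticTwist (discr K : ℚ) = Wd) ∧ Nat.card (Wd.selmerGroup 2) = 2 := by
  obtain ⟨K, _, _, ℓ, hℓ, hℓn, -, -, hK, hd, hodd, hd3, hH, h2K, hsq1, hsq2⟩ := exists_prime_heegnerField W n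
  haveI := Fact.mk hℓ
  -- a globally minimal model of the twist
  have hd0 : ((discr K : ℤ) : ℚ) ≠ 0 := by exact_mod_cast NumberField.discr_ne_zero K
  haveI := W.isElliptic_quadraticTwist hd0
  obtain ⟨C, hC⟩ := hasGlobalMinimalModel_rat_holds (W.quadraticTwist ((discr K : ℤ) : ℚ))
  haveI := hC
  refine ⟨K, inferInstance, inferInstance, ℓ, hℓ, hℓn, hK, hd, hodd, hd3, hH, hsq1, hsq2, h2K,
    existsUnique_zmod_root_of_discr_eq_neg_prime_of_Δ_neg W hK hodd hH hd hΔ,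
    C • W.quadraticTwist ((discr K : ℤ) : ℚ), inferInstance, hC, ⟨C, rfl⟩, ?_⟩
  exact natCard_selmerGroup_twin_eq_two_of_facts W hPT hEP hpar hCT hmod hΔ hK hodd hH h2K hd _ ⟨C, rfl⟩ h1

/-! ## §39 SUPPLY″ on the habitat, modulo {PT, Tate χ, 2-parity, Cassels–Tate, modularity, T-A, T-V} — no Mazur–Rubin named fact -/

/-- **SUPPLY″ («MinimalTwinSupplyDEF1») on the habitat cut out by `#Sel₂(E) ∈ {1, 4}` and `ε(E) = +1` on `Δ > 0` row 1, modulo print/typed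
facts BY NAME — gk2-p5 g8's `supply_DEF1_minimalTwin_of_duality` VERBATIM with `MazurRubin2010.prop33_rat` REPLACED by {2-parity (route item
`TwoParityDD`), Cassels–Tate (route item `CasselsTatePairingRat`), modularity (route item `ModularityExistsNewform`)}**, the other displayed
facts unchanged: Poitou–Tate duality + Tate's χ `hPT`, `hEP` (Δ<0: `#Sel₂ = 1` via UP §38, `#Sel₂ = 4` via gk2-p4 g7 twisting primes ∘
gk2-p5 g8 DOWN), T-A `F1Sign2.AdmissibleTwistSelmerShiftAtTwo` (Δ>0, `#Sel₂ = 1`) and T-V `F1Sign2.StrictShaPropagationAtTwo` (Δ>0, `#Sel₂ = 4`,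
`¬ DescentSignNeg`); every Čebotarev / Dirichlet input is PROVED. NO Mazur–Rubin named fact (`cor34i_singleton_rat`, `prop33_rat`) remains.
Statement: for `W/ℚ` globally minimal elliptic with `ρ̄_{W,2}` onto, rank `0`, `#Sel₂(W) ∈ {1, 4}`, and `¬ F1Sign2.DescentSignNeg W` whenever
`Δ_W > 0` and `#Sel₂(W) = 4`: beyond every bound `b` there is a prime `ℓ ≡ 7 (mod 8)`, `ℓ ∤ N_W`, such that `K = ℚ(√−ℓ)` carries EVERY K-clause
of crux 22136 with `2` split, DEF(W,K) = 1 in root-count currency, and the twist has a GLOBALLY MINIMAL model `Wd ≅ W^{(−ℓ)}` with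
`#Sel₂(Wd) = 2`. The twin's analytic rank one is NOT asserted. BSD is not proved by any of this.
[cite: MazurRubin2010, Prop. 3.3, Cor. 3.4 (i), Prop. 5.3] [cite: DokchitserDokchitserAnnals2010, Thm. 1.4] [cite: Kramer1981, Prop. 6]
[cite: GrossLMS1991, §1 (p. 235)] -/
theorem supply_DEF1_minimalTwin_of_facts
    (hPT : poitouTate_selmerStructure_duality_real ℚ)
    (hEP : ∀ v : IsDedekindDomain.HeightOneSpectrum (𝓞 ℚ), localEulerPoincareCharacteristic (v.adicCompletion ℚ))
    (hpar : ∀ V : WeierstrassCurve ℚ, p_parity V 2)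
    (hCT : WeierstrassCurve.exists_casselsTate_pairing (K := ℚ)) (hmod : exists_isNewformOf)
    (hA : AdmissibleTwistSelmerShiftAtTwo) (hV : StrictShaPropagationAtTwo)
    (hsurj : W.HasSurjectiveModNGaloisRep 2) (hr : W.mordellWeilRank = 0)
    (h14 : Nat.card (W.selmerGroup 2) = 1 ∨ Nat.card (W.selmerGroup 2) = 4)
    (hε : 0 < W.Δ → Nat.card (W.selmerGroup 2) = 4 → ¬ DescentSignNeg W) (b : ℕ) :
    ∃ ℓ : ℕ, b < ℓ ∧ ℓ.Prime ∧ ℓ % 8 = 7 ∧ ¬ ℓ ∣ W.conductorNorm ℤ ∧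
      ((W.Δ < 0 ∧ ∃! x : ZMod ℓ, 4 * x ^ 3 + ((integralModelInt W).b₂ : ZMod ℓ) * x ^ 2 +
          2 * ((integralModelInt W).b₄ : ZMod ℓ) * x + ((integralModelInt W).b₆ : ZMod ℓ) = 0) ∨
        (0 < W.Δ ∧ ∀ x : ZMod ℓ, 4 * x ^ 3 + ((integralModelInt W).b₂ : ZMod ℓ) * x ^ 2 +
          2 * ((integralModelInt W).b₄ : ZMod ℓ) * x + ((integralModelInt W).b₆ : ZMod ℓ) ≠ 0)) ∧
      ∃ (K : Type) (_ : Field K) (_ : NumberField K), IsImaginaryQuadratic K ∧ discr K = -(ℓ : ℤ) ∧ Odd (discr K) ∧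
        discr K ≠ -3 ∧ SatisfiesHeegnerHypothesis (W.conductorNorm ℤ) K ∧
        ¬ IsSquare ((discr K : ℚ) * -|W.Δ|) ∧ ¬ IsSquare ((discr K : ℚ) * (-(2 * |W.Δ|))) ∧
        ((Ideal.span {(2 : ℤ)}).primesOver (𝓞 K)).ncard = 2 ∧
        ∃ (Wd : WeierstrassCurve ℚ) (_ : Wd.IsElliptic) (_ : Wd.IsGloballyMinimal),
          (∃ C : VariableChange ℚ, C • W.quadraticTwist (discr K : ℚ) = Wd) ∧ Nat.card (Wd.selmerGroup 2) = 2 := by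
  rcases lt_or_gt_of_ne W.isUnit_Δ.ne_zero with hΔ | hΔ
  · -- `Δ < 0`: prime Heegner fields are transposition fields (DEF = 1 for free)
    rcases h14 with h1 | h4
    · obtain ⟨K, _, _, ℓ, hℓ, hb, hK, hd, hodd, hd3, hH, hsq1, hsq2, h2K, huniq, Wd, _, _, hWd, hSel⟩ :=
        exists_prime_heegnerField_minimalTwin_of_facts W hPT hEP hpar hCT hmod hΔ h1 b
      obtain ⟨-, hℓN, -⟩ := prime_discr_facts W hK hodd hH hℓ hd
      have hℓ8 : ℓ % 8 = 7 := by
        have h8 := (Quadratic.ncard_primesOver_two_eq_two_iff hK.1).mp h2K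
        rw [hd] at h8
        omega
      exact ⟨ℓ, hb, hℓ, hℓ8, hℓN, Or.inl ⟨hΔ, huniq⟩, K, inferInstance, inferInstance, hK, hd, hodd, hd3, hH, hsq1, hsq2,
        h2K, Wd, inferInstance, inferInstance, hWd, hSel⟩
    · obtain ⟨ℓ, hℓ, hb, hℓ8, hℓ2N, K, _, _, hK, hd, hodd, hd3, hH, hsq1, hsq2, h2K, huniq, Wd, _, _, hWd, hSel⟩ :=
        supply_DEF1_minimalTwin_rowOne_of_duality W hPT hEP hΔ hsurj h4 b
      have hℓN : ¬ ℓ ∣ W.conductorNorm ℤ := fun h => hℓ2N (Dvd.dvd.mul_left h 2)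
      exact ⟨ℓ, hb, hℓ, hℓ8, hℓN, Or.inl ⟨hΔ, huniq⟩, K, inferInstance, inferInstance, hK, hd, hodd, hd3, hH, hsq1, hsq2,
        h2K, Wd, inferInstance, inferInstance, hWd, hSel⟩
  · -- `Δ > 0`: silent prime Heegner fields (DEF = 1), the sign `ε(W)` on row 1
    rcases h14 with h1 | h4
    · obtain ⟨ℓ, hb, hℓ, hsil, K, _, _, hK, hd, hodd, hd3, hH, hsq1, hsq2, h2K, -, Wd, _, _, hWd, hSel⟩ :=
        supply_DEF1_posDisc W hA hΔ hsurj h1 b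
      obtain ⟨-, hℓN, -⟩ := prime_discr_facts W hK hodd hH hℓ hd
      have hℓ8 : ℓ % 8 = 7 := by
        have h8 := (Quadratic.ncard_primesOver_two_eq_two_iff hK.1).mp h2K
        rw [hd] at h8
        omega
      exact ⟨ℓ, hb, hℓ, hℓ8, hℓN, Or.inr ⟨hΔ, hsil⟩, K, inferInstance, inferInstance, hK, hd, hodd, hd3, hH, hsq1, hsq2,
        h2K, Wd, inferInstance, inferInstance, hWd, hSel⟩
    · obtain ⟨ℓ, hb, hℓ, hsil, K, _, _, hK, hd, hodd, hd3, hH, hsq1, hsq2, h2K, -, Wd, _, _, hWd, hSel⟩ :=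
        supply_DEF1_posDisc_rowOne_of_not_descentSignNeg W hV hΔ hsurj hr h4 (hε hΔ h4) b
      obtain ⟨-, hℓN, -⟩ := prime_discr_facts W hK hodd hH hℓ hd
      have hℓ8 : ℓ % 8 = 7 := by
        have h8 := (Quadratic.ncard_primesOver_two_eq_two_iff hK.1).mp h2K
        rw [hd] at h8
        omega
      exact ⟨ℓ, hb, hℓ, hℓ8, hℓN, Or.inr ⟨hΔ, hsil⟩, K, inferInstance, inferInstance, hK, hd, hodd, hd3, hH, hsq1, hsq2,
        h2K, Wd, inferInstance, inferInstance, hWd, hSel⟩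

/-- **The same under the binders of crux 22136** (`r_an(W) = 0` with the Gross–Zagier–Kolyvagin fact
`rank_eq_analyticRank_of_analyticRank_le_one` = item 19921 BY NAME; `ρ_{W,2^n}` onto for every `n ≥ 1`): gk2-p5 g8's
`supply_DEF1_minimalTwin_habitat_of_duality` with `prop33_rat` replaced by {2-parity, Cassels–Tate, modularity}.
[cite: MazurRubin2010, Prop. 3.3, Cor. 3.4 (i), Prop. 5.3] [cite: DokchitserDokchitserAnnals2010, Thm. 1.4] -/
theorem supply_DEF1_minimalTwin_habitat_of_facts
    (hPT : poitouTate_selmerStructure_duality_real ℚ)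
    (hEP : ∀ v : IsDedekindDomain.HeightOneSpectrum (𝓞 ℚ), localEulerPoincareCharacteristic (v.adicCompletion ℚ))
    (hpar : ∀ V : WeierstrassCurve ℚ, p_parity V 2)
    (hCT : WeierstrassCurve.exists_casselsTate_pairing (K := ℚ)) (hmod : exists_isNewformOf)
    (hA : AdmissibleTwistSelmerShiftAtTwo) (hV : StrictShaPropagationAtTwo)
    (hGZK : rank_eq_analyticRank_of_analyticRank_le_one) (hr0 : W.analyticRank = 0)
    (hρ : ∀ n : ℕ, 0 < n → W.HasSurjectiveModNGaloisRep ((2 : ℤ) ^ n))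
    (h14 : Nat.card (W.selmerGroup 2) = 1 ∨ Nat.card (W.selmerGroup 2) = 4)
    (hε : 0 < W.Δ → Nat.card (W.selmerGroup 2) = 4 → ¬ DescentSignNeg W) (b : ℕ) :
    ∃ ℓ : ℕ, b < ℓ ∧ ℓ.Prime ∧ ℓ % 8 = 7 ∧ ¬ ℓ ∣ W.conductorNorm ℤ ∧
      ((W.Δ < 0 ∧ ∃! x : ZMod ℓ, 4 * x ^ 3 + ((integralModelInt W).b₂ : ZMod ℓ) * x ^ 2 +
          2 * ((integralModelInt W).b₄ : ZMod ℓ) * x + ((integralModelInt W).b₆ : ZMod ℓ) = 0) ∨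
        (0 < W.Δ ∧ ∀ x : ZMod ℓ, 4 * x ^ 3 + ((integralModelInt W).b₂ : ZMod ℓ) * x ^ 2 +
          2 * ((integralModelInt W).b₄ : ZMod ℓ) * x + ((integralModelInt W).b₆ : ZMod ℓ) ≠ 0)) ∧
      ∃ (K : Type) (_ : Field K) (_ : NumberField K), IsImaginaryQuadratic K ∧ discr K = -(ℓ : ℤ) ∧ Odd (discr K) ∧
        discr K ≠ -3 ∧ SatisfiesHeegnerHypothesis (W.conductorNorm ℤ) K ∧
        ¬ IsSquare ((discr K : ℚ) * -|W.Δ|) ∧ ¬ IsSquare ((discr K : ℚ) * (-(2 * |W.Δ|))) ∧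
        ((Ideal.span {(2 : ℤ)}).primesOver (𝓞 K)).ncard = 2 ∧
        ∃ (Wd : WeierstrassCurve ℚ) (_ : Wd.IsElliptic) (_ : Wd.IsGloballyMinimal),
          (∃ C : VariableChange ℚ, C • W.quadraticTwist (discr K : ℚ) = Wd) ∧ Nat.card (Wd.selmerGroup 2) = 2 := by
  have hr : W.mordellWeilRank = 0 := by rw [(hGZK W (by rw [hr0]; exact zero_le_one)).1, hr0]
  exact supply_DEF1_minimalTwin_of_facts W hPT hEP hpar hCT hmod hA hV (by simpa using hρ 1 one_pos) hr h14 hε b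

/-! ## R-128 retype (director-bsd 2026-08-29 17:42Z, T-Q381-1′; seat bsd-line-gk2-p2 g21): PRINT-FORM TWINS
Every theorem below is the byte-identical twin of the theorem of the same name without the trailing prime, with the ONE change
that the `2`-parity hypothesis is typed as print has it — `∀ (V : WeierstrassCurve ℚ) [V.IsElliptic], p_parity V 2`
(Dokchitser–Dokchitser 2010 Thm. 1.4, elliptic curves; = route item `TwoParityDD` after rev 34) — instead of the bare closure
`∀ V : WeierstrassCurve ℚ, p_parity V 2` over all Weierstrass cubics (singular ones included: off print, undischargeable).
Calls to other retyped theorems go to their primed twins; every application `hpar W` is at an elliptic curve, so the proofs are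
unchanged. The unprimed originals are kept (append-only tree) and are superseded by these. BSD is NOT proved by any of this. -/

/-- **R-128 retype** (director-bsd 2026-08-29, T-Q381-1′) of `exists_prime_heegnerField_minimalTwin_of_facts`: the SAME statement and proof with the `2`-parity hypothesis in PRINT form `∀ (V : WeierstrassCurve ℚ) [V.IsElliptic], p_parity V 2` (Dokchitser–Dokchitser 2010 Thm. 1.4 is about elliptic curves; the bare closure over all Weierstrass cubics was off print). **`#Sel₂(W) = 1`, `Δ_W < 0`: beyond every bound a prime Heegner field `K = ℚ(√−ℓ)` carrying every K-clause of crux 22136, `2` split,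
DEF = 1 (one root of the `2`-division cubic mod `ℓ`), and a GLOBALLY MINIMAL twin `Wd ≅ W^{(−ℓ)}` with `#Sel₂(Wd) = 2`** — gk2-p5 g6's
`exists_prime_heegnerField_minimalTwin_of_prop33` with `MazurRubin2010.prop33_rat` REPLACED by the displayed print items {Poitou–Tate duality,
Tate's local Euler characteristic, 2-parity, Cassels–Tate, modularity} (the `#Sel₂ = 1 ⟹ twin = 2` step is Cor. 3.4 (i) UP for the trivially
strict `Sel₂(W) = 0`, `natCard_selmerGroup_twin_eq_two_of_facts'`). [cite: MazurRubin2010, Cor. 3.4 (i), Prop. 3.3]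
[cite: DokchitserDokchitserAnnals2010, Thm. 1.4] [cite: GrossLMS1991, §1 (p. 235)] -/
theorem exists_prime_heegnerField_minimalTwin_of_facts'
    (hPT : poitouTate_selmerStructure_duality_real ℚ)
    (hEP : ∀ v : HeightOneSpectrum (𝓞 ℚ), localEulerPoincareCharacteristic (v.adicCompletion ℚ))
    (hpar : ∀ (V : WeierstrassCurve ℚ) [V.IsElliptic], p_parity V 2)
    (hCT : WeierstrassCurve.exists_casselsTate_pairing (K := ℚ)) (hmod : exists_isNewformOf)
    (hΔ : W.Δ < 0) (h1 : Nat.card (W.selmerGroup 2) = 1) (n : ℕ) :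
    ∃ (K : Type) (_ : Field K) (_ : NumberField K) (ℓ : ℕ), ℓ.Prime ∧ n < ℓ ∧
      IsImaginaryQuadratic K ∧ discr K = -(ℓ : ℤ) ∧ Odd (discr K) ∧ discr K ≠ -3 ∧
      SatisfiesHeegnerHypothesis (W.conductorNorm ℤ) K ∧
      ¬ IsSquare ((discr K : ℚ) * -|W.Δ|) ∧ ¬ IsSquare ((discr K : ℚ) * (-(2 * |W.Δ|))) ∧
      ((Ideal.span {(2 : ℤ)}).primesOver (𝓞 K)).ncard = 2 ∧
      (∃! x : ZMod ℓ, 4 * x ^ 3 + ((integralModelInt W).b₂ : ZMod ℓ) * x ^ 2 +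
        2 * ((integralModelInt W).b₄ : ZMod ℓ) * x + ((integralModelInt W).b₆ : ZMod ℓ) = 0) ∧
      ∃ (Wd : WeierstrassCurve ℚ) (_ : Wd.IsElliptic) (_ : Wd.IsGloballyMinimal),
        (∃ C : VariableChange ℚ, C • W.quadraticTwist (discr K : ℚ) = Wd) ∧ Nat.card (Wd.selmerGroup 2) = 2 := by
  obtain ⟨K, _, _, ℓ, hℓ, hℓn, -, -, hK, hd, hodd, hd3, hH, h2K, hsq1, hsq2⟩ := exists_prime_heegnerField W n
  haveI := Fact.mk hℓ
  -- a globally minimal model of the twist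
  have hd0 : ((discr K : ℤ) : ℚ) ≠ 0 := by exact_mod_cast NumberField.discr_ne_zero K
  haveI := W.isElliptic_quadraticTwist hd0
  obtain ⟨C, hC⟩ := hasGlobalMinimalModel_rat_holds (W.quadraticTwist ((discr K : ℤ) : ℚ))
  haveI := hC
  refine ⟨K, inferInstance, inferInstance, ℓ, hℓ, hℓn, hK, hd, hodd, hd3, hH, hsq1, hsq2, h2K,
    existsUnique_zmod_root_of_discr_eq_neg_prime_of_Δ_neg W hK hodd hH hd hΔ,
    C • W.quadraticTwist ((discr K : ℤ) : ℚ), inferInstance, hC, ⟨C, rfl⟩, ?_⟩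
  exact natCard_selmerGroup_twin_eq_two_of_facts' W hPT hEP hpar hCT hmod hΔ hK hodd hH h2K hd _ ⟨C, rfl⟩ h1

/-- **R-128 retype** (director-bsd 2026-08-29, T-Q381-1′) of `supply_DEF1_minimalTwin_of_facts`: the SAME statement and proof with the `2`-parity hypothesis in PRINT form `∀ (V : WeierstrassCurve ℚ) [V.IsElliptic], p_parity V 2` (Dokchitser–Dokchitser 2010 Thm. 1.4 is about elliptic curves; the bare closure over all Weierstrass cubics was off print). **SUPPLY″ («MinimalTwinSupplyDEF1») on the habitat cut out by `#Sel₂(E) ∈ {1, 4}` and `ε(E) = +1` on `Δ > 0` row 1, modulo print/typed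
facts BY NAME — gk2-p5 g8's `supply_DEF1_minimalTwin_of_duality` VERBATIM with `MazurRubin2010.prop33_rat` REPLACED by {2-parity (route item
`TwoParityDD`), Cassels–Tate (route item `CasselsTatePairingRat`), modularity (route item `ModularityExistsNewform`)}**, the other displayed
facts unchanged: Poitou–Tate duality + Tate's χ `hPT`, `hEP` (Δ<0: `#Sel₂ = 1` via UP §38, `#Sel₂ = 4` via gk2-p4 g7 twisting primes ∘
gk2-p5 g8 DOWN), T-A `F1Sign2.AdmissibleTwistSelmerShiftAtTwo` (Δ>0, `#Sel₂ = 1`) and T-V `F1Sign2.StrictShaPropagationAtTwo` (Δ>0, `#Sel₂ = 4`,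
`¬ DescentSignNeg`); every Čebotarev / Dirichlet input is PROVED. NO Mazur–Rubin named fact (`cor34i_singleton_rat`, `prop33_rat`) remains.
Statement: for `W/ℚ` globally minimal elliptic with `ρ̄_{W,2}` onto, rank `0`, `#Sel₂(W) ∈ {1, 4}`, and `¬ F1Sign2.DescentSignNeg W` whenever
`Δ_W > 0` and `#Sel₂(W) = 4`: beyond every bound `b` there is a prime `ℓ ≡ 7 (mod 8)`, `ℓ ∤ N_W`, such that `K = ℚ(√−ℓ)` carries EVERY K-clause
of crux 22136 with `2` split, DEF(W,K) = 1 in root-count currency, and the twist has a GLOBALLY MINIMAL model `Wd ≅ W^{(−ℓ)}` with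
`#Sel₂(Wd) = 2`. The twin's analytic rank one is NOT asserted. BSD is not proved by any of this.
[cite: MazurRubin2010, Prop. 3.3, Cor. 3.4 (i), Prop. 5.3] [cite: DokchitserDokchitserAnnals2010, Thm. 1.4] [cite: Kramer1981, Prop. 6]
[cite: GrossLMS1991, §1 (p. 235)] -/
theorem supply_DEF1_minimalTwin_of_facts'
    (hPT : poitouTate_selmerStructure_duality_real ℚ)
    (hEP : ∀ v : IsDedekindDomain.HeightOneSpectrum (𝓞 ℚ), localEulerPoincareCharacteristic (v.adicCompletion ℚ))
    (hpar : ∀ (V : WeierstrassCurve ℚ) [V.IsElliptic], p_parity V 2)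
    (hCT : WeierstrassCurve.exists_casselsTate_pairing (K := ℚ)) (hmod : exists_isNewformOf)
    (hA : AdmissibleTwistSelmerShiftAtTwo) (hV : StrictShaPropagationAtTwo)
    (hsurj : W.HasSurjectiveModNGaloisRep 2) (hr : W.mordellWeilRank = 0)
    (h14 : Nat.card (W.selmerGroup 2) = 1 ∨ Nat.card (W.selmerGroup 2) = 4)
    (hε : 0 < W.Δ → Nat.card (W.selmerGroup 2) = 4 → ¬ DescentSignNeg W) (b : ℕ) :
    ∃ ℓ : ℕ, b < ℓ ∧ ℓ.Prime ∧ ℓ % 8 = 7 ∧ ¬ ℓ ∣ W.conductorNorm ℤ ∧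
      ((W.Δ < 0 ∧ ∃! x : ZMod ℓ, 4 * x ^ 3 + ((integralModelInt W).b₂ : ZMod ℓ) * x ^ 2 +
          2 * ((integralModelInt W).b₄ : ZMod ℓ) * x + ((integralModelInt W).b₆ : ZMod ℓ) = 0) ∨
        (0 < W.Δ ∧ ∀ x : ZMod ℓ, 4 * x ^ 3 + ((integralModelInt W).b₂ : ZMod ℓ) * x ^ 2 +
          2 * ((integralModelInt W).b₄ : ZMod ℓ) * x + ((integralModelInt W).b₆ : ZMod ℓ) ≠ 0)) ∧
      ∃ (K : Type) (_ : Field K) (_ : NumberField K), IsImaginaryQuadratic K ∧ discr K = -(ℓ : ℤ) ∧ Odd (discr K) ∧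
        discr K ≠ -3 ∧ SatisfiesHeegnerHypothesis (W.conductorNorm ℤ) K ∧
        ¬ IsSquare ((discr K : ℚ) * -|W.Δ|) ∧ ¬ IsSquare ((discr K : ℚ) * (-(2 * |W.Δ|))) ∧
        ((Ideal.span {(2 : ℤ)}).primesOver (𝓞 K)).ncard = 2 ∧
        ∃ (Wd : WeierstrassCurve ℚ) (_ : Wd.IsElliptic) (_ : Wd.IsGloballyMinimal),
          (∃ C : VariableChange ℚ, C • W.quadraticTwist (discr K : ℚ) = Wd) ∧ Nat.card (Wd.selmerGroup 2) = 2 := by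
  rcases lt_or_gt_of_ne W.isUnit_Δ.ne_zero with hΔ | hΔ
  · -- `Δ < 0`: prime Heegner fields are transposition fields (DEF = 1 for free)
    rcases h14 with h1 | h4
    · obtain ⟨K, _, _, ℓ, hℓ, hb, hK, hd, hodd, hd3, hH, hsq1, hsq2, h2K, huniq, Wd, _, _, hWd, hSel⟩ :=
        exists_prime_heegnerField_minimalTwin_of_facts' W hPT hEP hpar hCT hmod hΔ h1 b
      obtain ⟨-, hℓN, -⟩ := prime_discr_facts W hK hodd hH hℓ hd
      have hℓ8 : ℓ % 8 = 7 := by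
        have h8 := (Quadratic.ncard_primesOver_two_eq_two_iff hK.1).mp h2K
        rw [hd] at h8
        omega
      exact ⟨ℓ, hb, hℓ, hℓ8, hℓN, Or.inl ⟨hΔ, huniq⟩, K, inferInstance, inferInstance, hK, hd, hodd, hd3, hH, hsq1, hsq2,
        h2K, Wd, inferInstance, inferInstance, hWd, hSel⟩
    · obtain ⟨ℓ, hℓ, hb, hℓ8, hℓ2N, K, _, _, hK, hd, hodd, hd3, hH, hsq1, hsq2, h2K, huniq, Wd, _, _, hWd, hSel⟩ :=
        supply_DEF1_minimalTwin_rowOne_of_duality W hPT hEP hΔ hsurj h4 b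
      have hℓN : ¬ ℓ ∣ W.conductorNorm ℤ := fun h => hℓ2N (Dvd.dvd.mul_left h 2)
      exact ⟨ℓ, hb, hℓ, hℓ8, hℓN, Or.inl ⟨hΔ, huniq⟩, K, inferInstance, inferInstance, hK, hd, hodd, hd3, hH, hsq1, hsq2,
        h2K, Wd, inferInstance, inferInstance, hWd, hSel⟩
  · -- `Δ > 0`: silent prime Heegner fields (DEF = 1), the sign `ε(W)` on row 1
    rcases h14 with h1 | h4
    · obtain ⟨ℓ, hb, hℓ, hsil, K, _, _, hK, hd, hodd, hd3, hH, hsq1, hsq2, h2K, -, Wd, _, _, hWd, hSel⟩ :=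
        supply_DEF1_posDisc W hA hΔ hsurj h1 b
      obtain ⟨-, hℓN, -⟩ := prime_discr_facts W hK hodd hH hℓ hd
      have hℓ8 : ℓ % 8 = 7 := by
        have h8 := (Quadratic.ncard_primesOver_two_eq_two_iff hK.1).mp h2K
        rw [hd] at h8
        omega
      exact ⟨ℓ, hb, hℓ, hℓ8, hℓN, Or.inr ⟨hΔ, hsil⟩, K, inferInstance, inferInstance, hK, hd, hodd, hd3, hH, hsq1, hsq2,
        h2K, Wd, inferInstance, inferInstance, hWd, hSel⟩
    · obtain ⟨ℓ, hb, hℓ, hsil, K, _, _, hK, hd, hodd, hd3, hH, hsq1, hsq2, h2K, -, Wd, _, _, hWd, hSel⟩ :=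
        supply_DEF1_posDisc_rowOne_of_not_descentSignNeg W hV hΔ hsurj hr h4 (hε hΔ h4) b
      obtain ⟨-, hℓN, -⟩ := prime_discr_facts W hK hodd hH hℓ hd
      have hℓ8 : ℓ % 8 = 7 := by
        have h8 := (Quadratic.ncard_primesOver_two_eq_two_iff hK.1).mp h2K
        rw [hd] at h8
        omega
      exact ⟨ℓ, hb, hℓ, hℓ8, hℓN, Or.inr ⟨hΔ, hsil⟩, K, inferInstance, inferInstance, hK, hd, hodd, hd3, hH, hsq1, hsq2,
        h2K, Wd, inferInstance, inferInstance, hWd, hSel⟩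

/-- **R-128 retype** (director-bsd 2026-08-29, T-Q381-1′) of `supply_DEF1_minimalTwin_habitat_of_facts`: the SAME statement and proof with the `2`-parity hypothesis in PRINT form `∀ (V : WeierstrassCurve ℚ) [V.IsElliptic], p_parity V 2` (Dokchitser–Dokchitser 2010 Thm. 1.4 is about elliptic curves; the bare closure over all Weierstrass cubics was off print). **The same under the binders of crux 22136** (`r_an(W) = 0` with the Gross–Zagier–Kolyvagin fact
`rank_eq_analyticRank_of_analyticRank_le_one` = item 19921 BY NAME; `ρ_{W,2^n}` onto for every `n ≥ 1`): gk2-p5 g8's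
`supply_DEF1_minimalTwin_habitat_of_duality` with `prop33_rat` replaced by {2-parity, Cassels–Tate, modularity}.
[cite: MazurRubin2010, Prop. 3.3, Cor. 3.4 (i), Prop. 5.3] [cite: DokchitserDokchitserAnnals2010, Thm. 1.4] -/
theorem supply_DEF1_minimalTwin_habitat_of_facts'
    (hPT : poitouTate_selmerStructure_duality_real ℚ)
    (hEP : ∀ v : IsDedekindDomain.HeightOneSpectrum (𝓞 ℚ), localEulerPoincareCharacteristic (v.adicCompletion ℚ))
    (hpar : ∀ (V : WeierstrassCurve ℚ) [V.IsElliptic], p_parity V 2)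
    (hCT : WeierstrassCurve.exists_casselsTate_pairing (K := ℚ)) (hmod : exists_isNewformOf)
    (hA : AdmissibleTwistSelmerShiftAtTwo) (hV : StrictShaPropagationAtTwo)
    (hGZK : rank_eq_analyticRank_of_analyticRank_le_one) (hr0 : W.analyticRank = 0)
    (hρ : ∀ n : ℕ, 0 < n → W.HasSurjectiveModNGaloisRep ((2 : ℤ) ^ n))
    (h14 : Nat.card (W.selmerGroup 2) = 1 ∨ Nat.card (W.selmerGroup 2) = 4)
    (hε : 0 < W.Δ → Nat.card (W.selmerGroup 2) = 4 → ¬ DescentSignNeg W) (b : ℕ) :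
    ∃ ℓ : ℕ, b < ℓ ∧ ℓ.Prime ∧ ℓ % 8 = 7 ∧ ¬ ℓ ∣ W.conductorNorm ℤ ∧
      ((W.Δ < 0 ∧ ∃! x : ZMod ℓ, 4 * x ^ 3 + ((integralModelInt W).b₂ : ZMod ℓ) * x ^ 2 +
          2 * ((integralModelInt W).b₄ : ZMod ℓ) * x + ((integralModelInt W).b₆ : ZMod ℓ) = 0) ∨
        (0 < W.Δ ∧ ∀ x : ZMod ℓ, 4 * x ^ 3 + ((integralModelInt W).b₂ : ZMod ℓ) * x ^ 2 +
          2 * ((integralModelInt W).b₄ : ZMod ℓ) * x + ((integralModelInt W).b₆ : ZMod ℓ) ≠ 0)) ∧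
      ∃ (K : Type) (_ : Field K) (_ : NumberField K), IsImaginaryQuadratic K ∧ discr K = -(ℓ : ℤ) ∧ Odd (discr K) ∧
        discr K ≠ -3 ∧ SatisfiesHeegnerHypothesis (W.conductorNorm ℤ) K ∧
        ¬ IsSquare ((discr K : ℚ) * -|W.Δ|) ∧ ¬ IsSquare ((discr K : ℚ) * (-(2 * |W.Δ|))) ∧
        ((Ideal.span {(2 : ℤ)}).primesOver (𝓞 K)).ncard = 2 ∧
        ∃ (Wd : WeierstrassCurve ℚ) (_ : Wd.IsElliptic) (_ : Wd.IsGloballyMinimal),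
          (∃ C : VariableChange ℚ, C • W.quadraticTwist (discr K : ℚ) = Wd) ∧ Nat.card (Wd.selmerGroup 2) = 2 := by
  have hr : W.mordellWeilRank = 0 := by rw [(hGZK W (by rw [hr0]; exact zero_le_one)).1, hr0]
  exact supply_DEF1_minimalTwin_of_facts' W hPT hEP hpar hCT hmod hA hV (by simpa using hρ 1 one_pos) hr h14 hε b


end Summit.BirchSwinnertonDyer.BirchSwinnertonDyer.Theorems.GenusKolyTwin

end
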